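import Literature.AlgebraicGeometry.Modules.SerreTwistModBaseChange
import Literature.AlgebraicGeometry.Motives.IntegralProjectiveSpace
import HarnessLib

/-!
# `N(e)` depends only on the charts `Z_j` and the chart functions `x_i/x_j`: transfer of Serre twists between two
# structure maps to projective spaces (Hartshorne II Prop. 5.12 (c); Stacks Project Tag 01MX)

Layer `Literature/AlgebraicGeometry/Modules`, namespace `Literature.AlgebraicGeometry.Modules.SerreTwist`; THEOREMS ONLY.
Cell `hodgecm-mathlib` (D-0151), F-5 (5d-I) carve-out (γ1b) part A (B-p19 (g16); HOME-ONLY draft per B-plan1 (g17) 09:59:12Z (I)).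

For two structure maps `ι₁ : Y ⟶ 𝐏ʳ_A`, `ι₂ : Y ⟶ 𝐏ʳ_{A'}` of the SAME scheme `Y` with the same charts (`Y_j := ι₁⁻¹D₊(x_j) =
ι₂⁻¹D₊(x_j)`, as mutual inclusions `h₁₂`, `h₂₁`) and the same chart functions (`(x_i/x_j)|` agree, `hc`), the twisted modules
`twistMod ι₁ N e` and `twistMod ι₂ N e` of ★ `Modules/SerreTwistMod` are canonically isomorphic, componentwise by restriction
along the equal opens (`exists_twistMod_iso_of_Zop_le`).  The case in point (part B, file `Modules/SerreTwistModProjMap`):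
`ι₁ = ι₂ ≫ Proj.map (A[x] → A'[x])` for a ring map `A → A'` (Mathlib `Proj.map_preimage_basicOpen`,
`Proj.awayToSection_comp_appLE`).

Count-neutral capital (`--supports stmt-HodgeConjecture-24835`); HC_CM is proved only modulo the 7 printed citations until rung 0
closes, and this file discharges none of them.

## References
* [Hartshorne1977] R. Hartshorne, *Algebraic Geometry* (1977), II Prop. 5.12 (c) (p. 117).
* [StacksProject] The Stacks Project, Tag 01MX.
-/

noncomputable section

-- `TopCat.Presheaf`/`Scheme.Modules` are not reducible (as in Mathlib's `AlgebraicGeometry/Modules/Sheaf.lean`).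
set_option backward.isDefEq.respectTransparency false

open CategoryTheory AlgebraicGeometry TopologicalSpace Opposite

universe u

namespace Literature.AlgebraicGeometry.Modules

namespace SerreTwist

open Literature.AlgebraicGeometry.Morphisms Literature.AlgebraicGeometry.Morphisms.ProjCech

variable {A A' : Type u} [CommRing A] [CommRing A'] {r : ℕ} {Y : Scheme.{u}} (ι₁ : Y ⟶ PP A r) (ι₂ : Y ⟶ PP A' r)
  (N : Y.Modules) (e : ℕ)

/-- **Transferred chart families satisfy the transition rule.**  If `Y_j(ι₂) ⊆ Y_j(ι₁)` for all `j` and the chart functions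
of `ι₁` restrict to those of `ι₂`, then restricting the chart pieces of a section of `twistMod ι₁ N e` to the charts of `ι₂`
gives a twist family for `ι₂`. [cite: Hartshorne1977, II Prop. 5.12 (c)] -/
theorem isTwistFamily_transfer (h₂₁ : ∀ j : Fin (r + 1), Zop ι₂ {j} ≤ Zop ι₁ {j})
    (hc : ∀ i j : Fin (r + 1), Y.presheaf.map (homOfLE (h₂₁ j)).op (chartFun ι₁ i j) = chartFun ι₂ i j)
    {U : Y.Opens} (n : Γ(twistMod ι₁ N e, U)) :
    IsTwistFamily ι₂ N e U fun j => N.presheaf.map (homOfLE (inf_le_inf_left U (h₂₁ j))).op (comp ι₁ N n j) := by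
  intro j j' W hW hj hj'
  have key := isTwistFamily_comp ι₁ N n j j' (V := W) hW (hj.trans (h₂₁ j)) (hj'.trans (h₂₁ j'))
  rw [moduleMap_map_apply, moduleMap_map_apply, ← hc j' j, IsTwistSection.map_map_apply]
  exact key

/-- **A morphism `twistMod ι₁ N e ⟶ twistMod ι₂ N e` transferring chart pieces** (★ `homMkTwist`), with its chart formula.
[cite: Hartshorne1977, II Prop. 5.12 (c)] -/
theorem exists_hom_transfer (h₂₁ : ∀ j : Fin (r + 1), Zop ι₂ {j} ≤ Zop ι₁ {j})
    (hc : ∀ i j : Fin (r + 1), Y.presheaf.map (homOfLE (h₂₁ j)).op (chartFun ι₁ i j) = chartFun ι₂ i j) :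
    ∃ ψ : twistMod ι₁ N e ⟶ twistMod ι₂ N e, ∀ (U : Y.Opens) (n : Γ(twistMod ι₁ N e, U)) (j : Fin (r + 1)),
      comp ι₂ N (ψ.app U n) j = N.presheaf.map (homOfLE (inf_le_inf_left U (h₂₁ j))).op (comp ι₁ N n j) := by
  refine ⟨homMkTwist ι₂ N e
    (fun U =>
      { toFun := fun n => mkFamily ι₂ N _ (isTwistFamily_transfer ι₁ ι₂ N e h₂₁ hc n)
        map_zero' := twistMod_ext ι₂ N fun j => by rw [comp_mkFamily, comp_zero, comp_zero, map_zero]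
        map_add' := fun n n' => twistMod_ext ι₂ N fun j => by
          rw [comp_mkFamily, comp_add, comp_add, comp_mkFamily, comp_mkFamily, map_add] })
    (fun U V h n j => ?_) (fun U a n j => ?_), fun U n j => rfl⟩
  · change N.presheaf.map _ (comp ι₁ N ((twistMod ι₁ N e).presheaf.map (homOfLE h).op n) j) =
      N.presheaf.map _ (N.presheaf.map _ (comp ι₁ N n j))
    rw [comp_map, moduleMap_map_apply, moduleMap_map_apply]
  · change N.presheaf.map _ (comp ι₁ N (a • n) j) = _ • N.presheaf.map _ (comp ι₁ N n j)
    rw [comp_smul, Scheme.Modules.map_smul, IsTwistSection.map_map_apply]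

/-- The hypothesis on chart functions is symmetric: if `(x_i/x_j)(ι₁)` restricts to `(x_i/x_j)(ι₂)` on `Y_j(ι₂) = Y_j(ι₁)`,
then conversely. [cite: Hartshorne1977, II Prop. 5.12 (c)] -/
theorem chartFun_transfer_symm (h₁₂ : ∀ j : Fin (r + 1), Zop ι₁ {j} ≤ Zop ι₂ {j})
    (h₂₁ : ∀ j : Fin (r + 1), Zop ι₂ {j} ≤ Zop ι₁ {j})
    (hc : ∀ i j : Fin (r + 1), Y.presheaf.map (homOfLE (h₂₁ j)).op (chartFun ι₁ i j) = chartFun ι₂ i j)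
    (i j : Fin (r + 1)) :
    Y.presheaf.map (homOfLE (h₁₂ j)).op (chartFun ι₂ i j) = chartFun ι₁ i j := by
  rw [← hc i j, IsTwistSection.map_map_apply]
  have h : homOfLE ((h₁₂ j).trans (h₂₁ j)) = 𝟙 (Zop ι₁ {j}) := Subsingleton.elim _ _
  rw [h, op_id, CategoryTheory.Functor.map_id]
  rfl

/-- **`twistMod ι₁ N e ≅ twistMod ι₂ N e` when the two structure maps have the same charts and chart functions**, with the
chart formula `(φ n)_j = n_j|` (restriction along `U ∩ Y_j(ι₂) ⊆ U ∩ Y_j(ι₁)`). [cite: Hartshorne1977, II Prop. 5.12 (c)]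
[cite: StacksProject, Tag 01MX] -/
theorem exists_twistMod_iso_of_Zop_le (h₁₂ : ∀ j : Fin (r + 1), Zop ι₁ {j} ≤ Zop ι₂ {j})
    (h₂₁ : ∀ j : Fin (r + 1), Zop ι₂ {j} ≤ Zop ι₁ {j})
    (hc : ∀ i j : Fin (r + 1), Y.presheaf.map (homOfLE (h₂₁ j)).op (chartFun ι₁ i j) = chartFun ι₂ i j) :
    ∃ φ : twistMod ι₁ N e ≅ twistMod ι₂ N e, ∀ (U : Y.Opens) (n : Γ(twistMod ι₁ N e, U)) (j : Fin (r + 1)),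
      comp ι₂ N (φ.hom.app U n) j = N.presheaf.map (homOfLE (inf_le_inf_left U (h₂₁ j))).op (comp ι₁ N n j) := by
  obtain ⟨ψ, hψ⟩ := exists_hom_transfer ι₁ ι₂ N e h₂₁ hc
  obtain ⟨ψ', hψ'⟩ := exists_hom_transfer ι₂ ι₁ N e h₁₂ (chartFun_transfer_symm ι₁ ι₂ h₁₂ h₂₁ hc)
  refine ⟨⟨ψ, ψ', ?_, ?_⟩, hψ⟩
  · ext U n j
    rw [Scheme.Modules.Hom.comp_app, CategoryTheory.comp_apply, Scheme.Modules.Hom.id_app, CategoryTheory.id_apply,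
      hψ', hψ, moduleMap_map_of_eq]
  · ext U n j
    rw [Scheme.Modules.Hom.comp_app, CategoryTheory.comp_apply, Scheme.Modules.Hom.id_app, CategoryTheory.id_apply,
      hψ, hψ', moduleMap_map_of_eq]

/-! ### Part B: change of the target along `Proj.map (K[x] → L[x])` -/

section ProjMap

open Literature.AlgebraicGeometry.Motives Literature.Algebra.Homology Literature.Algebra.Homology.LaurentCech
  HomogeneousLocalization

attribute [local instance] MvPolynomial.gradedAlgebra

variable (K L : Type u) [CommRing K] [CommRing L] [Algebra K L] {r : ℕ}

/-- `K[x] → L[x]` maps the monomial `X_s` to `X_s`. [folklore] -/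
private theorem mapGraded_Xs (s : Finset (Fin (r + 1))) :
    ProjBaseChangeRing.mapGraded K L (Fin (r + 1)) (Xs K s) = Xs L s := by
  rw [ProjBaseChangeRing.mapGraded_apply, Xs, Xs, map_prod]
  exact Finset.prod_congr rfl fun i _ => MvPolynomial.map_X _ i

/-- **`(Proj (K[x] → L[x]))⁻¹ D₊(X_s) = D₊(X_s)`** (Mathlib `Proj.map_preimage_basicOpen`). [cite: StacksProject, Tag 01MX] -/
theorem projMap_preimage_Dplus (s : Finset (Fin (r + 1))) :
    Proj.map (ProjBaseChangeRing.mapGraded K L (Fin (r + 1))) (ProjBaseChangeRing.irrelevant_le_map K L (Fin (r + 1))) ⁻¹ᵁ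
        Dplus K r s = Dplus L r s := by
  change Proj.basicOpen (grading L r) (ProjBaseChangeRing.mapGraded K L (Fin (r + 1)) (Xs K s)) =
    Proj.basicOpen (grading L r) (Xs L s)
  rw [mapGraded_Xs]

variable {Y : Scheme.{u}} (ιY : Y ⟶ PP L r)

/-- **The charts agree**: `Y_s` computed through `ιY ≫ Proj (K[x] → L[x]) : Y → 𝐏ʳ_K` is `Y_s` computed through `ιY`.
[cite: StacksProject, Tag 01MX] -/
theorem Zop_comp_projMap (s : Finset (Fin (r + 1))) :
    Zop (ιY ≫ Proj.map (ProjBaseChangeRing.mapGraded K L (Fin (r + 1)))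
      (ProjBaseChangeRing.irrelevant_le_map K L (Fin (r + 1)))) s = Zop ιY s := by
  change ιY ⁻¹ᵁ (Proj.map (ProjBaseChangeRing.mapGraded K L (Fin (r + 1)))
    (ProjBaseChangeRing.irrelevant_le_map K L (Fin (r + 1))) ⁻¹ᵁ Dplus K r s) = ιY ⁻¹ᵁ Dplus L r s
  rw [projMap_preimage_Dplus]

/-- On sections over `D₊(s)`, `Proj g` is `(K[x]_s)₀ → (L[x]_{g s})₀` (Mathlib `Proj.awayToSection_comp_appLE`, elementwise).
[cite: StacksProject, Tag 01MX] -/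
theorem projMap_app_awayToSection {s : MvPolynomial (Fin (r + 1)) K} {m : ℕ} (hs : s ∈ grading K r m)
    (x : Away (grading K r) s) :
    (Proj.map (ProjBaseChangeRing.mapGraded K L (Fin (r + 1))) (ProjBaseChangeRing.irrelevant_le_map K L (Fin (r + 1)))).app
        (Proj.basicOpen (grading K r) s) (Proj.awayToSection (grading K r) s x) =
      Proj.awayToSection (grading L r) (ProjBaseChangeRing.mapGraded K L (Fin (r + 1)) s)
        (Away.map (ProjBaseChangeRing.mapGraded K L (Fin (r + 1))) s x) := by
  have h := congrArg (fun φ => φ.hom x) (Proj.awayToSection_comp_appLE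
    (ProjBaseChangeRing.mapGraded K L (Fin (r + 1))) (ProjBaseChangeRing.irrelevant_le_map K L (Fin (r + 1))) hs)
  simp only [CommRingCat.hom_comp, RingHom.comp_apply, CommRingCat.hom_ofHom] at h
  rw [Scheme.Hom.app_eq_appLE]
  exact h

/-- **The fraction `X_t^{|j|}/X_j^{|t|}` is preserved**: `Proj g` pulls the section `X_t/X_j` of `𝒪_{𝐏ʳ_K}` over `D₊(X_j)` back to
the section `X_t/X_j` of `𝒪_{𝐏ʳ_L}` (checked pointwise in the homogeneous localizations at the points of `D₊(X_j)`).
[cite: StacksProject, Tag 01MX] -/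
theorem map_projMap_app_awayToSection_isLocalizationElem (j : Fin (r + 1)) (t : Finset (Fin (r + 1))) :
    (PP L r).presheaf.map (homOfLE (projMap_preimage_Dplus K L ({j} : Finset (Fin (r + 1)))).ge).op
        ((Proj.map (ProjBaseChangeRing.mapGraded K L (Fin (r + 1)))
            (ProjBaseChangeRing.irrelevant_le_map K L (Fin (r + 1)))).app (Dplus K r {j})
          (Proj.awayToSection (grading K r) (Xs K {j})
            (Away.isLocalizationElem (Xs_mem (A := K) {j}) (Xs_mem (A := K) t)))) =
      Proj.awayToSection (grading L r) (Xs L {j})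
        (Away.isLocalizationElem (Xs_mem (A := L) {j}) (Xs_mem (A := L) t)) := by
  rw [projMap_app_awayToSection K L (Xs_mem (A := K) {j})]
  apply Subtype.ext
  funext p
  change HomogeneousLocalization.mapId (grading L r) _
      (Away.map (ProjBaseChangeRing.mapGraded K L (Fin (r + 1))) (Xs K {j})
        (Away.isLocalizationElem (Xs_mem (A := K) {j}) (Xs_mem (A := K) t))) =
    HomogeneousLocalization.mapId (grading L r) _ (Away.isLocalizationElem (Xs_mem (A := L) {j}) (Xs_mem (A := L) t))
  apply HomogeneousLocalization.val_injective
  simp only [Away.isLocalizationElem, Away.mk, HomogeneousLocalization.Away.map, HomogeneousLocalization.mapId,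
    HomogeneousLocalization.map_mk, HomogeneousLocalization.val_mk, map_pow, mapGraded_Xs, GradedRingHom.id_apply]

/-- **The chart functions agree**: `x_i/x_j` on `Y_j` computed through `ιY ≫ Proj (K[x] → L[x])` restricts to `x_i/x_j` computed
through `ιY`. [cite: StacksProject, Tag 01MX] -/
theorem map_chartFun_comp_projMap (i j : Fin (r + 1)) :
    Y.presheaf.map (homOfLE (Zop_comp_projMap K L ιY ({j} : Finset (Fin (r + 1)))).ge).op
        (chartFun (ιY ≫ Proj.map (ProjBaseChangeRing.mapGraded K L (Fin (r + 1)))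
          (ProjBaseChangeRing.irrelevant_le_map K L (Fin (r + 1)))) i j) = chartFun ιY i j := by
  change Y.presheaf.map _ (evalRing (ιY ≫ Proj.map (ProjBaseChangeRing.mapGraded K L (Fin (r + 1)))
      (ProjBaseChangeRing.irrelevant_le_map K L (Fin (r + 1)))) {j} (tElB K {i} j)) = evalRing ιY {j} (tElB L {i} j)
  rw [evalRing_apply, evalRing_apply, awayEquiv_symm_tElB, awayEquiv_symm_tElB, Scheme.Hom.comp_app,
    CategoryTheory.comp_apply,
    ← map_projMap_app_awayToSection_isLocalizationElem K L j ((({i} : Finset (Fin (r + 1))).erase j))]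
  have hnat := congrArg (fun φ => φ.hom ((Proj.map (ProjBaseChangeRing.mapGraded K L (Fin (r + 1)))
      (ProjBaseChangeRing.irrelevant_le_map K L (Fin (r + 1)))).app (Dplus K r {j})
        (Proj.awayToSection (grading K r) (Xs K {j})
          (Away.isLocalizationElem (Xs_mem (A := K) {j}) (Xs_mem (A := K) (({i} : Finset (Fin (r + 1))).erase j))))))
    (ιY.naturality (homOfLE (projMap_preimage_Dplus K L ({j} : Finset (Fin (r + 1)))).ge).op)
  simp only [CommRingCat.hom_comp, RingHom.comp_apply] at hnat
  exact hnat.symm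

/-- **`twistMod (ιY ≫ Proj (K[x] → L[x])) N e ≅ twistMod ιY N e`**: the Serre twist computed through the base-changed target
`𝐏ʳ_K` agrees with the one computed through `𝐏ʳ_L`, componentwise by restriction along the equal charts (Part A).
[cite: Hartshorne1977, II Prop. 5.12 (c)] [cite: StacksProject, Tag 01MX] -/
theorem exists_twistMod_comp_projMap_iso (N : Y.Modules) (e : ℕ) :
    ∃ φ : twistMod (ιY ≫ Proj.map (ProjBaseChangeRing.mapGraded K L (Fin (r + 1)))
        (ProjBaseChangeRing.irrelevant_le_map K L (Fin (r + 1)))) N e ≅ twistMod ιY N e,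
      ∀ (U : Y.Opens) (n : Γ(twistMod (ιY ≫ Proj.map (ProjBaseChangeRing.mapGraded K L (Fin (r + 1)))
        (ProjBaseChangeRing.irrelevant_le_map K L (Fin (r + 1)))) N e, U)) (j : Fin (r + 1)),
        comp ιY N (φ.hom.app U n) j =
          N.presheaf.map (homOfLE (inf_le_inf_left U (Zop_comp_projMap K L ιY ({j} : Finset (Fin (r + 1)))).ge)).op
            (comp _ N n j) :=
  exists_twistMod_iso_of_Zop_le _ ιY N e (fun j => (Zop_comp_projMap K L ιY {j}).le)
    (fun j => (Zop_comp_projMap K L ιY {j}).ge) (map_chartFun_comp_projMap K L ιY)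

end ProjMap

/-! ### Part C: monomial sections under transfer; the square form (fibres of a family over `𝐏ʳ_K`) -/

section Monomial

variable {A A' : Type u} [CommRing A] [CommRing A'] {r : ℕ} {Y : Scheme.{u}} (ι₁ : Y ⟶ PP A r) (ι₂ : Y ⟶ PP A' r)

/-- Under the transfer hypotheses the word functions `μ_w/x_j^e = Π_t x_{w t}/x_j` agree as well. [cite: Hartshorne1977, II Prop. 5.12 (c)] -/
theorem map_wordFun_transfer (h₂₁ : ∀ j : Fin (r + 1), Zop ι₂ {j} ≤ Zop ι₁ {j})
    (hc : ∀ i j : Fin (r + 1), Y.presheaf.map (homOfLE (h₂₁ j)).op (chartFun ι₁ i j) = chartFun ι₂ i j)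
    (j : Fin (r + 1)) {e : ℕ} (w : Fin e → Fin (r + 1)) :
    Y.presheaf.map (homOfLE (h₂₁ j)).op (wordFun ι₁ j w) = wordFun ι₂ j w := by
  rw [wordFun, wordFun, map_prod]
  exact Finset.prod_congr rfl fun t _ => hc (w t) j

/-- **A transfer morphism takes monomial sections to monomial sections**: if `ψ : twistMod ι₁ 𝒪 e ⟶ twistMod ι₂ 𝒪 e` restricts
chart pieces (the chart formula of `exists_twistMod_iso_of_Zop_le`), then `ψ(μ_w|) = μ_w|` (★ `SerreTwist.monomialSection`).
[cite: Hartshorne1977, II Prop. 5.12 (c)] -/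
theorem app_monomialSection_of_comp_eq (h₂₁ : ∀ j : Fin (r + 1), Zop ι₂ {j} ≤ Zop ι₁ {j})
    (hc : ∀ i j : Fin (r + 1), Y.presheaf.map (homOfLE (h₂₁ j)).op (chartFun ι₁ i j) = chartFun ι₂ i j) (e : ℕ)
    (ψ : twistMod ι₁ (unitModule Y) e ⟶ twistMod ι₂ (unitModule Y) e)
    (hψ : ∀ (U : Y.Opens) (n : Γ(twistMod ι₁ (unitModule Y) e, U)) (j : Fin (r + 1)),
      comp ι₂ (unitModule Y) (ψ.app U n) j =
        (unitModule Y).presheaf.map (homOfLE (inf_le_inf_left U (h₂₁ j))).op (comp ι₁ (unitModule Y) n j))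
    (w : Fin e → Fin (r + 1)) :
    ψ.app ⊤ (monomialSection ι₁ e w) = monomialSection ι₂ e w := by
  apply twistMod_ext
  intro j
  rw [hψ]
  change Y.presheaf.map _ (show Γ(Y, ⊤ ⊓ Zop ι₁ {j}) from comp ι₁ (unitModule Y) (monomialSection ι₁ e w) j) =
    (show Γ(Y, ⊤ ⊓ Zop ι₂ {j}) from comp ι₂ (unitModule Y) (monomialSection ι₂ e w) j)
  rw [comp_monomialSection_eq_map_wordFun, comp_monomialSection_eq_map_wordFun, ← map_wordFun_transfer ι₁ ι₂ h₂₁ hc j w,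
    IsTwistSection.map_map_apply, IsTwistSection.map_map_apply]

/-- Equal structure maps have the same chart functions (restriction along the trivially equal charts).
[cite: Hartshorne1977, II Prop. 5.12 (c)] -/
theorem map_chartFun_of_eq {ι₁ ι₂ : Y ⟶ PP A r} (h : ι₁ = ι₂) (i j : Fin (r + 1)) :
    Y.presheaf.map (homOfLE (h ▸ le_rfl : Zop ι₂ {j} ≤ Zop ι₁ {j})).op (chartFun ι₁ i j) = chartFun ι₂ i j := by
  subst h
  have hid : homOfLE (le_rfl : Zop ι₁ {j} ≤ Zop ι₁ {j}) = 𝟙 (Zop ι₁ {j}) := Subsingleton.elim _ _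
  rw [hid, op_id, CategoryTheory.Functor.map_id]
  rfl

end Monomial

section Square

open Literature.AlgebraicGeometry.Motives

attribute [local instance] MvPolynomial.gradedAlgebra

variable (K L : Type u) [CommRing K] [CommRing L] [Algebra K L] {r : ℕ} {X₀ Z : Scheme.{u}}
  (k : X₀ ⟶ Z) (ιZ : Z ⟶ PP K r) (ιK : X₀ ⟶ PP L r)
  (w : k ≫ ιZ = ιK ≫ Proj.map (ProjBaseChangeRing.mapGraded K L (Fin (r + 1)))
    (ProjBaseChangeRing.irrelevant_le_map K L (Fin (r + 1))))

include w in
/-- In a commutative square `k ≫ ιZ = ιK ≫ Proj (K[x] → L[x])` the charts of `X₀` are the preimages of the charts of `Z`: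
`X₀,j ⊆ k⁻¹ Z_j` (indeed equal). [cite: StacksProject, Tag 01MX] -/
theorem Zop_le_preimage_of_sq (s : Finset (Fin (r + 1))) : Zop ιK s ≤ k ⁻¹ᵁ Zop ιZ s := by
  rw [← Zop_comp_projMap K L ιK s, ← Zop_comp k ιZ s, w]

include w in
/-- **Base change of `𝒪(e)` in a square over `Proj (K[x] → L[x])`** (e.g. the fibre `X₀ ⊂ 𝐏ʳ_L` of a family `Z ⊂ 𝐏ʳ_K` over an
`L`-valued point): `k^* 𝒪_Z(e) ≅ 𝒪_{X₀}(e) := twistMod ιK 𝒪 e`, with the chart formula on pulled-back sections and **`η_k(μ_w|_Z) ↦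
μ_w|_{X₀}`** (★ `isIso_pullbackTwistHom` + the transfers of Parts A–B). [cite: Hartshorne1977, II Prop. 5.12 (c)] [cite: StacksProject, Tag 01MX] -/
theorem exists_pullback_twistMod_iso_of_sq (e : ℕ) :
    ∃ φ : (Scheme.Modules.pullback k).obj (twistMod ιZ (unitModule Z) e) ≅ twistMod ιK (unitModule X₀) e,
      (∀ ⦃V : Z.Opens⦄ ⦃U : X₀.Opens⦄ (hU : U ≤ k ⁻¹ᵁ V) (s : Γ(twistMod ιZ (unitModule Z) e, V)) (j : Fin (r + 1)),
        (show Γ(X₀, U ⊓ Zop ιK {j}) from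
            comp ιK (unitModule X₀) (φ.hom.app U (unitSectionLE k (twistMod ιZ (unitModule Z) e) hU s)) j) =
          k.appLE (V ⊓ Zop ιZ {j}) (U ⊓ Zop ιK {j}) (inf_le_inf hU (Zop_le_preimage_of_sq K L k ιZ ιK w {j}))
            (show Γ(Z, V ⊓ Zop ιZ {j}) from comp ιZ (unitModule Z) s j)) ∧
      ∀ wd : Fin e → Fin (r + 1),
        φ.hom.app ⊤ (unitSectionLE k (twistMod ιZ (unitModule Z) e) (V := ⊤) (U := ⊤) le_top (monomialSection ιZ e wd)) =
          monomialSection ιK e wd := by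
  haveI := isIso_pullbackTwistHom k ιZ e
  -- transfer along the equality `k ≫ ιZ = ιK ≫ π`, then along `π`
  have h₂₁ : ∀ j : Fin (r + 1), Zop (ιK ≫ Proj.map (ProjBaseChangeRing.mapGraded K L (Fin (r + 1)))
      (ProjBaseChangeRing.irrelevant_le_map K L (Fin (r + 1)))) {j} ≤ Zop (k ≫ ιZ) {j} := fun j => w ▸ le_rfl
  have h₁₂ : ∀ j : Fin (r + 1), Zop (k ≫ ιZ) {j} ≤ Zop (ιK ≫ Proj.map (ProjBaseChangeRing.mapGraded K L (Fin (r + 1)))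
      (ProjBaseChangeRing.irrelevant_le_map K L (Fin (r + 1)))) {j} := fun j => w ▸ le_rfl
  have hc := map_chartFun_of_eq (Y := X₀) w
  obtain ⟨φ₂, hφ₂⟩ := exists_twistMod_iso_of_Zop_le _ _ (unitModule X₀) e h₁₂ h₂₁ hc
  have h₂₁' : ∀ j : Fin (r + 1), Zop ιK {j} ≤ Zop (ιK ≫ Proj.map (ProjBaseChangeRing.mapGraded K L (Fin (r + 1)))
      (ProjBaseChangeRing.irrelevant_le_map K L (Fin (r + 1)))) {j} := fun j => (Zop_comp_projMap K L ιK {j}).ge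
  obtain ⟨φ₃, hφ₃⟩ := exists_twistMod_comp_projMap_iso K L ιK (unitModule X₀) e
  refine ⟨asIso (pullbackTwistHom k ιZ e) ≪≫ φ₂ ≪≫ φ₃, fun V U hU s j => ?_, fun wd => ?_⟩
  · change (show Γ(X₀, U ⊓ Zop ιK {j}) from comp ιK (unitModule X₀)
        (φ₃.hom.app U (φ₂.hom.app U ((pullbackTwistHom k ιZ e).app U
          (unitSectionLE k (twistMod ιZ (unitModule Z) e) hU s)))) j) = _
    rw [hφ₃, hφ₂, pullbackTwistHom_app_unitSectionLE]
    change X₀.presheaf.map _ (X₀.presheaf.map _ (show Γ(X₀, U ⊓ Zop (k ≫ ιZ) {j}) from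
      comp (k ≫ ιZ) (unitModule X₀) (pullSection k ιZ e hU s) j)) = _
    rw [comp_pullSection]
    exact (congrArg _ (map_appLE_apply k _ _ _)).trans (map_appLE_apply k _ _ _)
  · change φ₃.hom.app ⊤ (φ₂.hom.app ⊤ ((pullbackTwistHom k ιZ e).app ⊤
      (unitSectionLE k (twistMod ιZ (unitModule Z) e) le_top (monomialSection ιZ e wd)))) = _
    rw [pullbackTwistHom_app_unitSectionLE_monomialSection,
      app_monomialSection_of_comp_eq _ _ h₂₁ hc e φ₂.hom hφ₂ wd,
      app_monomialSection_of_comp_eq _ _ h₂₁' (map_chartFun_comp_projMap K L ιK) e φ₃.hom hφ₃ wd]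

end Square

end SerreTwist

end Literature.AlgebraicGeometry.Modules

end
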